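import Mathlib
import Literature.NumberTheory.NumberFields.PureCubicNormCubicResidueClasses
import Literature.NumberTheory.NumberFields.PureCubicDegreeOnePrimes
import HarnessLib

/-!
# Pure cubic fields: explicit non-principal prime ideals from cubic non-residues

Topic `NumberTheory/NumberFields`.  Theorem-only file (no definition, no named fact, D-0026),
unconditional; an explicit corollary of the rational genus character
(`PureCubicNormCubicResidueClasses.lean`) and Dedekind–Kummer for `ℚ(∛m)`
(`PureCubicDegreeOnePrimes.lean`).  Let `K` be a cubic number field, `θ ∈ 𝓞_K` with `θ³ = m`
(`m` not a cube), `ℓ ≡ 1 (mod 3)` a prime with `3 ∤ v_ℓ(m)`, and `p ∤ 3m` a prime which is NOT a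
cubic residue modulo `ℓ`.  For every cube root `r` of `m` modulo `p` the prime ideal
`𝔭 = (p, θ − r)` has norm `p`, so its rational genus character `(N𝔭 / ℓ)₃ = (p / ℓ)₃` is
non-trivial:

* `Honda1971.three_dvd_orderOf_mk0_span_pair` — **the ideal class of `(p, θ − r)` has order
  divisible by `3`**;
* `Honda1971.not_isPrincipal_span_pair` — in particular `(p, θ − r)` is not principal.

(E.g. `m = 14`, `ℓ = 7`, `p = 5`: `5` is not a cube mod `7`, `14 ≡ 4 = 4³ (mod 5)`, so
`(5, ∛14 − 4)` is a non-principal prime of `ℚ(∛14)` whose class has order divisible by `3`.)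

> P. Barrucand, H. Cohn, *A rational genus, class number divisibility, and unit theory for pure
> cubic fields*, J. Number Theory 2 (1970) 7–21.

## References

* P. Barrucand, H. Cohn, J. Number Theory 2 (1970) 7–21. [BarrucandCohn1970]
* H. Cohen, *A Course in Computational Algebraic Number Theory* (1993), §6.4. [Cohen1993]
-/

noncomputable section

open Polynomial NumberField IsDedekindDomain
open scoped nonZeroDivisors

namespace Literature.NumberTheory.NumberFields

namespace Honda1971

variable {K : Type*} [Field K] [NumberField K]

/-- **Explicit ideal classes of order divisible by `3`.**  `K` cubic, `θ ∈ 𝓞_K`, `θ³ = m`;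
`ℓ ≡ 1 (mod 3)` prime with `3 ∤ v_ℓ(m)`; `p ∤ 3m` a prime that is not a cube modulo `ℓ`; `r` a
cube root of `m` mod `p`.  Then the class of the prime ideal `(p, θ − r)` (of norm `p`) has order
divisible by `3`. [cite: BarrucandCohn1970] [cite: Cohen1993, §6.4] -/
theorem three_dvd_orderOf_mk0_span_pair {ℓ m p : ℕ} (hℓ : ℓ.Prime) (hℓ1 : ℓ % 3 = 1)
    (hm : ¬ 3 ∣ padicValNat ℓ m) (h3 : Module.finrank ℚ K = 3) {θ : 𝓞 K}
    (hθ : θ ^ 3 = (m : 𝓞 K)) (hp : p.Prime) (hpm : ¬ p ∣ 3 * m)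
    (hpℓ : ∀ u : (ZMod ℓ)ˣ, (u : ZMod ℓ) ^ 3 ≠ (p : ZMod ℓ)) {r : ℤ}
    (hr : (r : ZMod p) ^ 3 = (m : ZMod p))
    (h0 : Ideal.span {(p : 𝓞 K), θ - (r : 𝓞 K)} ∈ (Ideal (𝓞 K))⁰) :
    3 ∣ orderOf (ClassGroup.mk0 ⟨Ideal.span {(p : 𝓞 K), θ - (r : 𝓞 K)}, h0⟩) := by
  have hcube : ∀ s : ℕ, s ^ 3 ≠ m := fun s hs =>
    pow_three_ne_of_not_dvd_padicValNat hℓ hm (s : ℚ) (by exact_mod_cast hs)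
  have hα : ((θ : K)) ^ 3 = (m : K) := by
    have := congrArg (fun x : 𝓞 K => (x : K)) hθ
    simpa using this
  have hnorm : Ideal.absNorm (Ideal.span {(p : 𝓞 K), θ - (r : 𝓞 K)}) = p :=
    PureCubic.absNorm_span_pair h3 hcube hθ hp hpm hr
  have hpℓ' : ¬ ℓ ∣ p := by
    intro h
    have : ℓ = p := (Nat.prime_dvd_prime_iff_eq hℓ hp).mp h
    subst this
    -- `3 ∤ v_ℓ(m)` forces `ℓ ∣ m`, contradicting `ℓ ∤ 3m`
    have hℓm : ℓ ∣ m := by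
      by_contra hnd
      rw [padicValNat.eq_zero_of_not_dvd hnd] at hm
      exact hm (dvd_zero 3)
    exact hpm (dvd_mul_of_dvd_right hℓm 3)
  refine three_dvd_orderOf_mk0 hℓ hℓ1 hm h3 hα ⟨_, h0⟩ ?_ ?_
  · change ¬ ℓ ∣ Ideal.absNorm (Ideal.span {(p : 𝓞 K), θ - (r : 𝓞 K)})
    rw [hnorm]; exact hpℓ'
  · change ∀ u : (ZMod ℓ)ˣ, (u : ZMod ℓ) ^ 3 ≠
      (Ideal.absNorm (Ideal.span {(p : 𝓞 K), θ - (r : 𝓞 K)}) : ZMod ℓ)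
    rw [hnorm]; exact hpℓ

/-- The prime ideal `(p, θ − r)` is nonzero (its norm is `p`). [folklore] -/
theorem span_pair_mem_nonZeroDivisors {ℓ m p : ℕ} (hℓ : ℓ.Prime)
    (hm : ¬ 3 ∣ padicValNat ℓ m) (h3 : Module.finrank ℚ K = 3) {θ : 𝓞 K}
    (hθ : θ ^ 3 = (m : 𝓞 K)) (hp : p.Prime) (hpm : ¬ p ∣ 3 * m) {r : ℤ}
    (hr : (r : ZMod p) ^ 3 = (m : ZMod p)) :
    Ideal.span {(p : 𝓞 K), θ - (r : 𝓞 K)} ∈ (Ideal (𝓞 K))⁰ := by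
  have hcube : ∀ s : ℕ, s ^ 3 ≠ m := fun s hs =>
    pow_three_ne_of_not_dvd_padicValNat hℓ hm (s : ℚ) (by exact_mod_cast hs)
  have hnorm : Ideal.absNorm (Ideal.span {(p : 𝓞 K), θ - (r : 𝓞 K)}) = p :=
    PureCubic.absNorm_span_pair h3 hcube hθ hp hpm hr
  refine mem_nonZeroDivisors_iff_ne_zero.mpr fun h => ?_
  rw [h, Submodule.zero_eq_bot, Ideal.absNorm_bot] at hnorm
  exact hp.ne_zero hnorm.symm

/-- **Explicit non-principal prime ideals**: under the hypotheses of
`three_dvd_orderOf_mk0_span_pair`, the prime ideal `(p, θ − r)` of `K` is not principal (its norm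
`p` is not a cubic residue mod `ℓ`, while norms of principal ideals prime to `ℓ` are).
[cite: BarrucandCohn1970] -/
theorem not_isPrincipal_span_pair {ℓ m p : ℕ} (hℓ : ℓ.Prime) (hℓ1 : ℓ % 3 = 1)
    (hm : ¬ 3 ∣ padicValNat ℓ m) (h3 : Module.finrank ℚ K = 3) {θ : 𝓞 K}
    (hθ : θ ^ 3 = (m : 𝓞 K)) (hp : p.Prime) (hpm : ¬ p ∣ 3 * m)
    (hpℓ : ∀ u : (ZMod ℓ)ˣ, (u : ZMod ℓ) ^ 3 ≠ (p : ZMod ℓ)) {r : ℤ}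
    (hr : (r : ZMod p) ^ 3 = (m : ZMod p)) :
    ¬ (Ideal.span {(p : 𝓞 K), θ - (r : 𝓞 K)}).IsPrincipal := by
  have h0 := span_pair_mem_nonZeroDivisors hℓ hm h3 hθ hp hpm hr
  intro hprinc
  have h1 : ClassGroup.mk0 ⟨Ideal.span {(p : 𝓞 K), θ - (r : 𝓞 K)}, h0⟩ = 1 :=
    (ClassGroup.mk0_eq_one_iff h0).mpr hprinc
  have h3dvd := three_dvd_orderOf_mk0_span_pair hℓ hℓ1 hm h3 hθ hp hpm hpℓ hr h0
  rw [h1, orderOf_one] at h3dvd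
  omega

end Honda1971

end Literature.NumberTheory.NumberFields

end
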